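import Literature.NumberTheory.LFunctions.LevinsonMontgomerySigns
import Literature.NumberTheory.LFunctions.LevinsonMontgomeryBoxes
import Literature.NumberTheory.LFunctions.LevinsonMontgomeryBacklund
import Literature.NumberTheory.LFunctions.ZetaZerosProofs
import Literature.NumberTheory.LFunctions.RHWave0
import Literature.Analysis.Complex.HadamardGenusZeroProofs
import HarnessLib

/-!
# Levinson–Montgomery's Theorem 1: `N₁⁻(T) = N⁻(T) + O(log T)` and `N₁⁻(T_j) = N⁻(T_j)`

Trunk T-ANT (NumberTheory/LFunctions). Part D3 (the theorem itself) of the decomposition of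
`Literature.NumberTheory.LFunctions.speiser_iff` (`Literature/NumberTheory/LFunctions/RHClassicalEquivalents.lean`, rh.S18)
along N. Levinson, H. L. Montgomery, *Zeros of the derivatives of the Riemann zeta-function*,
Acta Math. 133 (1974), Theorem 1 and §2.

With `N⁻(T)`, `N₁⁻(T)` (`Literature.NumberTheory.LFunctions.zetaLeftCount`, `Literature.NumberTheory.LFunctions.derivZetaLeftCount`) the numbers of
zeros of `ζ`, `ζ'` in `R_T = {0 < σ < ½, 0 < t < T}` counted with multiplicity, Theorem 1 reads
(1.1) `N₁⁻(T) = N⁻(T) + O(log T)` and (1.2) "unless `N⁻(T) > T/2` for all large `T`, there is a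
sequence `T_j → ∞` with `N₁⁻(T_j) = N⁻(T_j)`". The proof (LM §2) applies the argument principle
to `ζ'/ζ` on the rectangle with vertices `10i, ½ + 10i, ½ + iT, iT` (here, following
Titchmarsh, *The Theory of the Riemann Zeta-Function* (1986) §10.28, with right edge
`σ = ½ - δ(T)` instead of an indented one): `Re ζ'/ζ < 0` on `σ = 0` and on `σ = ½ - δ`
(`|t| ≥ 10`), so the vertical edges contribute `< π` each to the change of `arg ζ'/ζ`, which is
`2π (N₁(K) - N(K))`; on the horizontal edges the changes of `arg ζ` and `arg ζ'` are `O(log T)`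
by Backlund's lemma (Titchmarsh §9.4) — this is (1.1); and at a *good* height `T` (at distance
`≥ ½` from the ordinates of all zeros off the critical line) `Re ζ'/ζ < 0` on the whole top edge,
so that if the bottom edge is good too the change of argument is `0` and `N₁(K) = N(K)` — this
is (1.2), the alternative being that every large integer height `n` is bad, which produces
distinct zeros `βₙ + iγₙ`, `βₙ < ½`, `|γₙ - n| < ½`, whence `N⁻(T) > T/2`.

(1.1) is proved here unconditionally (`Literature.NumberTheory.LFunctions.levinsonMontgomery_thm1_isBigO_holds`). For
(1.2), whose counts start at `t = 0` while the contour starts at `t = 10`, Levinson–Montgomery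
use two numerical facts: "`β = ½` for `|γ| < 1000`" (so that `t = 10` is a good height and
`N⁻(10) = 0`; Gram 1903 already covers `0 ≤ t ≤ 50`, Edwards, *Riemann's Zeta Function* §6.1)
and, tacitly, that `ζ'` has no zeros in `0 < σ < ½`, `0 < t ≤ 10` (Spira's 1965 computation,
quoted in Spira, Illinois J. Math. 17 (1973), p. 149: "`ζ'(s) ≠ 0` for `0 < σ < ½`,
`0 < |t| ≤ 200`, although only the region `|t| ≤ 100` was reported on"). We prove (1.2) from
exactly the low-height inputs the argument needs, stated as explicit hypotheses
(`Literature.NumberTheory.LFunctions.levinsonMontgomery_thm1_seq_of`: no zeros of `ζ` in `(0,½) × (0, 10.5]`, none of `ζ'`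
in `(0,½) × (0,10]`), vendor Spira's published computation as a named fact
(`Literature.NumberTheory.LFunctions.spira1965_deriv_riemannZeta_ne_zero`; the `ζ` input is the tree's numerical-RH notion
`Literature.NumberTheory.LFunctions.RiemannHypothesisInStripUpTo` / the named fact `Literature.NumberTheory.LFunctions.platt_trudgian_numerical_rh`, rh.S35),
and record the resulting forms of Speiser's theorem (`Literature.NumberTheory.LFunctions.speiser_iff_of_lowHeight`,
`Literature.NumberTheory.LFunctions.speiser_iff_of_rhUpTo_spira`, `Literature.NumberTheory.LFunctions.speiser_iff_of_platt_trudgian_spira`). The Hadamard-product input of the sign lemmas is now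
unconditional (`Literature.Analysis.Complex.hadamard_genus_zero_holds`), so none of the theorems below carries
an `XiProduct` parameter.

## Main results

* `Literature.NumberTheory.LFunctions.lmXiProduct` — Hadamard data for `ξ(½ + √z)`, unconditionally; hypothesis-free sign
  theorems `re_logDeriv_riemannZeta_neg_of_re_zero'`, `re_logDeriv_riemannZeta_neg_of_lmGood'`,
  `exists_strip_re_logDeriv_riemannZeta_neg`.
* `Literature.NumberTheory.LFunctions.exists_lmBox` — the rectangle `[0, ½-δ] × [t₁, t₂]` and its edge properties.
* `Literature.NumberTheory.LFunctions.two_pi_mul_abs_sub_le` — the box estimate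
  `2π |N₁(K) - N(K)| ≤ E(t₁) + E(t₂) + 2π`, `E(t) = lmEdgeBound 400 t + lmEdgeBound (16/15) t`;
  `Literature.NumberTheory.LFunctions.lmBoxDerivCount_eq_lmBoxCount_of_re_neg` — `N₁(K) = N(K)` when `Re ζ'/ζ < 0` on `∂K`.
* `Literature.NumberTheory.LFunctions.levinsonMontgomery_thm1_isBigO_holds` — **(1.1), proved**.
* `Literature.NumberTheory.LFunctions.derivZetaLeftCount_sub_eq_of_re_neg` — `N₁⁻(T) - N⁻(T) = N₁⁻(t₁) - N⁻(t₁)` between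
  good heights; `Literature.NumberTheory.LFunctions.frequently_lmGood_nat` — the dichotomy of LM §2;
  `Literature.NumberTheory.LFunctions.levinsonMontgomery_thm1_seq_of` — **(1.2) from the two low-height facts**.
* `Literature.NumberTheory.LFunctions.spira1965_deriv_riemannZeta_ne_zero` — Spira's computation as a named fact;
  `Literature.NumberTheory.LFunctions.speiser_iff_of_lowHeight`, `Literature.NumberTheory.LFunctions.speiser_iff_of_rhUpTo_spira`,
  `Literature.NumberTheory.LFunctions.speiser_iff_of_platt_trudgian_spira`.

## References

* N. Levinson, H. L. Montgomery, *Zeros of the derivatives of the Riemann zeta-function*, Acta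
  Math. 133 (1974), 49–65, Theorem 1 and §2.
* E. C. Titchmarsh, *The Theory of the Riemann Zeta-Function*, 2nd ed. (rev. D. R. Heath-Brown),
  OUP 1986, §9.4 and §10.28.
* H. M. Edwards, *Riemann's Zeta Function*, Academic Press 1974, §6.1.
* R. Spira, *Zeros of `ζ'(s)` and the Riemann hypothesis*, Illinois J. Math. 17 (1973), 147–152.
-/

noncomputable section

open Complex Set MeasureTheory Filter Topology intervalIntegral Asymptotics
open scoped Real

namespace Literature.NumberTheory.LFunctions

/-! ## Hadamard data and hypothesis-free sign theorems -/

/-- Hadamard data for `G(w²) = ξ(½+w)` (an `XiProduct`), unconditionally, from the tree's proof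
of the genus-zero Hadamard factorisation theorem. [folklore] -/
def lmXiProduct : XiProduct := XiProduct.ofHadamard Literature.Analysis.Complex.hadamard_genus_zero_holds

/-- `Re ζ'/ζ(s) < 0` forces `ζ(s) ≠ 0` and `ζ'(s) ≠ 0` (Lean's `logDeriv ζ s = ζ'(s)/ζ(s)`
vanishes if either factor does). [folklore] -/
lemma ne_zero_of_re_logDeriv_neg {s : ℂ} (h : (logDeriv riemannZeta s).re < 0) :
    riemannZeta s ≠ 0 ∧ deriv riemannZeta s ≠ 0 := by
  rw [logDeriv_apply] at h
  refine ⟨fun h0 ↦ ?_, fun h0 ↦ ?_⟩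
  · rw [h0, div_zero, zero_re] at h; exact lt_irrefl 0 h
  · rw [h0, zero_div, zero_re] at h; exact lt_irrefl 0 h

/-- **Left edge**, unconditionally: `Re ζ'/ζ(it) < 0` for `|t| ≥ 10`.
[cite: LevinsonMontgomery1974, §2] -/
theorem re_logDeriv_riemannZeta_neg_of_re_zero' {s : ℂ} (hre : s.re = 0) (ht : 10 ≤ |s.im|) :
    (logDeriv riemannZeta s).re < 0 :=
  re_logDeriv_riemannZeta_neg_of_re_zero lmXiProduct hre ht

/-- **Good heights**, unconditionally: at a good height `|t| ≥ 10`, `Re ζ'/ζ(σ+it) < 0` for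
`0 ≤ σ < ½`. [cite: LevinsonMontgomery1974, §2] -/
theorem re_logDeriv_riemannZeta_neg_of_lmGood' {s : ℂ} (hgood : lmGood s.im)
    (ht : 10 ≤ |s.im|) (h0 : 0 ≤ s.re) (h1 : s.re < 1 / 2) :
    (logDeriv riemannZeta s).re < 0 :=
  re_logDeriv_riemannZeta_neg_of_lmGood lmXiProduct hgood ht h0 h1

/-- **Right edge as a thin strip**, unconditionally: there is `δ₀ ∈ (0, ¼]` with
`Re ζ'/ζ(s) < 0` whenever `½ - δ₀ ≤ Re s < ½` and `10 ≤ |Im s| ≤ T` (Titchmarsh's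
`σ = ½ - δ`, `0 < δ ≤ δ₀`). In particular neither `ζ` nor `ζ'` vanishes there.
[cite: Titchmarsh1986, §10.28 eq. (10.28.6)] -/
theorem exists_strip_re_logDeriv_riemannZeta_neg (T : ℝ) :
    ∃ δ₀ : ℝ, 0 < δ₀ ∧ δ₀ ≤ 1 / 4 ∧ ∀ s : ℂ, 1 / 2 - δ₀ ≤ s.re → s.re < 1 / 2 →
      10 ≤ |s.im| → |s.im| ≤ T → (logDeriv riemannZeta s).re < 0 := by
  obtain ⟨δ₀, h0, h4, h⟩ := exists_delta_re_logDeriv_riemannZeta_neg lmXiProduct T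
  refine ⟨δ₀, h0, h4, fun s hs1 hs2 ht hT ↦ ?_⟩
  exact h (1 / 2 - s.re) (by linarith) (by linarith) s (by ring) ht hT

/-! ## The rectangle `K = [0, ½-δ] × [t₁, t₂]` -/

/-- **The rectangle.** For `10 ≤ t₁ < t₂` such that `ζ ζ' ≠ 0` on the open segments
`(0,½) × {t₁}` and `(0,½) × {t₂}`, there is `b ∈ (0,½)` (Titchmarsh's `½ - δ`) such that:
every zero of `ζ` or `ζ'` with `0 < σ < ½`, `10 ≤ |t| ≤ t₂` has `σ < b`; `ζ ζ' ≠ 0` on the closed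
horizontal edges `[0,b] × {t₁}`, `[0,b] × {t₂}`; and `Re ζ'/ζ < 0` on the vertical edges
`{0} × [t₁,t₂]`, `{b} × [t₁,t₂]`. [cite: LevinsonMontgomery1974, §2] -/
theorem exists_lmBox {t₁ t₂ : ℝ} (ht₁ : 10 ≤ t₁) (h12 : t₁ < t₂)
    (H1 : ∀ x ∈ Ioo (0 : ℝ) (1 / 2),
      riemannZeta (x + t₁ * I) ≠ 0 ∧ deriv riemannZeta (x + t₁ * I) ≠ 0)
    (H2 : ∀ x ∈ Ioo (0 : ℝ) (1 / 2),
      riemannZeta (x + t₂ * I) ≠ 0 ∧ deriv riemannZeta (x + t₂ * I) ≠ 0) :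
    ∃ b : ℝ, 0 < b ∧ b < 1 / 2 ∧
      (∀ ρ : ℂ, (riemannZeta ρ = 0 ∨ deriv riemannZeta ρ = 0) → 0 < ρ.re → ρ.re < 1 / 2 →
        10 ≤ |ρ.im| → |ρ.im| ≤ t₂ → ρ.re < b) ∧
      (∀ x ∈ Icc 0 b, riemannZeta (x + t₁ * I) ≠ 0 ∧ deriv riemannZeta (x + t₁ * I) ≠ 0) ∧
      (∀ x ∈ Icc 0 b, riemannZeta (x + t₂ * I) ≠ 0 ∧ deriv riemannZeta (x + t₂ * I) ≠ 0) ∧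
      (∀ y ∈ Icc t₁ t₂, (logDeriv riemannZeta (((0 : ℝ) : ℂ) + y * I)).re < 0) ∧
      (∀ y ∈ Icc t₁ t₂, (logDeriv riemannZeta (b + y * I)).re < 0) := by
  obtain ⟨δ₀, hδ0, hδ4, hδ⟩ := exists_strip_re_logDeriv_riemannZeta_neg t₂
  have hleft : ∀ t : ℝ, 10 ≤ t →
      riemannZeta (((0 : ℝ) : ℂ) + t * I) ≠ 0 ∧ deriv riemannZeta (((0 : ℝ) : ℂ) + t * I) ≠ 0 := by
    intro t ht
    apply ne_zero_of_re_logDeriv_neg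
    apply re_logDeriv_riemannZeta_neg_of_re_zero' (by simp)
    simpa [abs_of_nonneg (show (0 : ℝ) ≤ t by linarith)] using ht
  refine ⟨1 / 2 - δ₀, by linarith, by linarith, ?_, ?_, ?_, ?_, ?_⟩
  · intro ρ hρ h0 h1 ht hT
    by_contra hle
    push Not at hle
    have := ne_zero_of_re_logDeriv_neg (hδ ρ hle h1 ht hT)
    rcases hρ with h | h
    · exact this.1 h
    · exact this.2 h
  · intro x hx
    rcases eq_or_lt_of_le hx.1 with h | h
    · rw [← h]
      exact hleft t₁ ht₁
    · exact H1 x ⟨h, by linarith [hx.2]⟩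
  · intro x hx
    rcases eq_or_lt_of_le hx.1 with h | h
    · rw [← h]
      exact hleft t₂ (by linarith)
    · exact H2 x ⟨h, by linarith [hx.2]⟩
  · intro y hy
    apply re_logDeriv_riemannZeta_neg_of_re_zero' (by simp)
    have : (10 : ℝ) ≤ y := by linarith [hy.1]
    simpa [abs_of_nonneg (show (0 : ℝ) ≤ y by linarith)] using this
  · intro y hy
    have hy0 : (0 : ℝ) ≤ y := by linarith [hy.1]
    apply hδ
    · simp
    · simp [hδ0]
    · simpa [abs_of_nonneg hy0] using (show (10 : ℝ) ≤ y by linarith [hy.1])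
    · simpa [abs_of_nonneg hy0] using hy.2

/-- A point `x + yi` with `y > 0` is not the pole `1`. [folklore] -/
lemma ofReal_add_mul_I_ne_one_of_im_pos {x y : ℝ} (hy : 0 < y) : (x : ℂ) + y * I ≠ 1 := by
  intro h
  have := congrArg Complex.im h
  simp at this
  linarith

/-- `Im (2π i n) = 2π n`. [folklore] -/
lemma im_two_pi_I_mul_intCast (n : ℤ) : (2 * π * I * (n : ℂ)).im = 2 * π * n := by
  simp [mul_im, mul_re]

/-- **The box estimate** (LM §2, proof of (1.1)): for the rectangle `K = [0,b] × [t₁,t₂]`,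
`0 < b ≤ ½`, `10 ≤ t₁ < t₂`, with `ζ ζ' ≠ 0` on the horizontal edges and `Re ζ'/ζ < 0` on the
vertical ones,
`2π |N₁(K) - N(K)| ≤ E(t₁) + E(t₂) + 2π`, where `E(t) = lmEdgeBound 400 t + lmEdgeBound (16/15) t`
bounds the variation of `arg ζ'` plus that of `arg ζ` along `[0,b] × {t}` (Backlund's lemma,
`Literature.NumberTheory.LFunctions.abs_im_integral_logDeriv_deriv_riemannZeta_le`, `Literature.NumberTheory.LFunctions.abs_im_integral_logDeriv_riemannZeta_le`)
and each vertical edge contributes at most `π` (`Literature.NumberTheory.LFunctions.abs_im_integral_logDeriv_vertical_le_pi`).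
[cite: LevinsonMontgomery1974, §2] -/
theorem two_pi_mul_abs_sub_le {b t₁ t₂ : ℝ} (hb : 0 < b) (hb' : b ≤ 1 / 2) (ht₁ : 10 ≤ t₁)
    (ht : t₁ < t₂)
    (h_bot : ∀ x ∈ Icc 0 b, riemannZeta (x + t₁ * I) ≠ 0 ∧ deriv riemannZeta (x + t₁ * I) ≠ 0)
    (h_top : ∀ x ∈ Icc 0 b, riemannZeta (x + t₂ * I) ≠ 0 ∧ deriv riemannZeta (x + t₂ * I) ≠ 0)
    (h_left : ∀ y ∈ Icc t₁ t₂, (logDeriv riemannZeta (((0 : ℝ) : ℂ) + y * I)).re < 0)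
    (h_right : ∀ y ∈ Icc t₁ t₂, (logDeriv riemannZeta (b + y * I)).re < 0) :
    2 * π * |((lmBoxDerivCount b t₁ t₂ - lmBoxCount b t₁ t₂ : ℤ) : ℝ)| ≤
      (lmEdgeBound 400 t₁ + lmEdgeBound (16 / 15) t₁) +
        (lmEdgeBound 400 t₂ + lmEdgeBound (16 / 15) t₂) + 2 * π := by
  have h_left' : ∀ y ∈ Icc t₁ t₂, riemannZeta (((0 : ℝ) : ℂ) + y * I) ≠ 0 ∧
      deriv riemannZeta (((0 : ℝ) : ℂ) + y * I) ≠ 0 :=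
    fun y hy ↦ ne_zero_of_re_logDeriv_neg (h_left y hy)
  have h_right' : ∀ y ∈ Icc t₁ t₂, riemannZeta (b + y * I) ≠ 0 ∧
      deriv riemannZeta (b + y * I) ≠ 0 :=
    fun y hy ↦ ne_zero_of_re_logDeriv_neg (h_right y hy)
  have hid := rectBoundaryIntegral_logDeriv_logDeriv_riemannZeta hb (by linarith) ht h_bot h_top
    h_left' h_right'
  rw [Literature.Analysis.Complex.rectBoundaryIntegral_def] at hid
  have him := congrArg Complex.im hid
  rw [im_two_pi_I_mul_intCast] at him
  simp only [sub_im, add_im] at him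
  -- horizontal edges: `h = ζ''/ζ' - ζ'/ζ` and Backlund
  have hne1 : ∀ {x y : ℝ}, t₁ ≤ y → (x : ℂ) + y * I ≠ 1 := fun hy ↦
    ofReal_add_mul_I_ne_one_of_im_pos (by linarith)
  have horiz : ∀ {y : ℝ}, t₁ ≤ y →
      (∀ x ∈ Icc 0 b, riemannZeta (x + y * I) ≠ 0 ∧ deriv riemannZeta (x + y * I) ≠ 0) →
      |(∫ x : ℝ in (0 : ℝ)..b, deriv (logDeriv riemannZeta) (x + y * I) /
          logDeriv riemannZeta (x + y * I)).im| ≤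
        lmEdgeBound 400 y + lmEdgeBound (16 / 15) y := by
    intro y hy h0
    have hy8 : 8 ≤ y := by linarith
    have hb12 : b ≤ 12 := by linarith
    have heq : ∫ x : ℝ in (0 : ℝ)..b, deriv (logDeriv riemannZeta) (x + y * I) /
        logDeriv riemannZeta (x + y * I) =
        (∫ x : ℝ in (0 : ℝ)..b, deriv (deriv riemannZeta) (x + y * I) /
          deriv riemannZeta (x + y * I)) -
        ∫ x : ℝ in (0 : ℝ)..b, deriv riemannZeta (x + y * I) / riemannZeta (x + y * I) := by
      rw [← intervalIntegral.integral_sub]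
      · apply intervalIntegral.integral_congr
        intro x hx
        rw [uIcc_of_le hb.le] at hx
        exact logDeriv_logDeriv_riemannZeta (hne1 hy) (h0 x hx).1 (h0 x hx).2
      · refine Literature.Analysis.Complex.intervalIntegrable_of_continuousAt_horizontal
          (F := fun z ↦ deriv (deriv riemannZeta) z / deriv riemannZeta z) y hb.le fun x hx ↦ ?_
        have ha : AnalyticAt ℂ (deriv riemannZeta) (x + y * I) :=
          analyticOnNhd_deriv_riemannZeta _ (hne1 hy)
        exact ha.deriv.continuousAt.div ha.continuousAt (h0 x hx).2
      · refine Literature.Analysis.Complex.intervalIntegrable_of_continuousAt_horizontal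
          (F := fun z ↦ deriv riemannZeta z / riemannZeta z) y hb.le fun x hx ↦ ?_
        have ha : AnalyticAt ℂ riemannZeta (x + y * I) := analyticOn_riemannZeta _ (hne1 hy)
        exact ha.deriv.continuousAt.div ha.continuousAt (h0 x hx).1
    rw [heq, sub_im]
    have h1 := abs_im_integral_logDeriv_deriv_riemannZeta_le hy8 hb.le hb12 (fun x hx ↦ (h0 x hx).2)
    have h2 := abs_im_integral_logDeriv_riemannZeta_le hy8 hb.le hb12 (fun x hx ↦ (h0 x hx).1)
    calc _ ≤ |(∫ x : ℝ in (0 : ℝ)..b, deriv (deriv riemannZeta) (x + y * I) /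
              deriv riemannZeta (x + y * I)).im| +
            |(∫ x : ℝ in (0 : ℝ)..b, deriv riemannZeta (x + y * I) /
              riemannZeta (x + y * I)).im| := abs_sub _ _
      _ ≤ _ := add_le_add h1 h2
  have hB := horiz le_rfl h_bot
  have hT := horiz ht.le h_top
  -- vertical edges: `Re ζ'/ζ < 0`
  have vert : ∀ {x : ℝ}, (∀ y ∈ Icc t₁ t₂, (logDeriv riemannZeta (x + y * I)).re < 0) →
      |(I * ∫ y : ℝ in t₁..t₂, deriv (logDeriv riemannZeta) (x + y * I) /
          logDeriv riemannZeta (x + y * I)).im| ≤ π := by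
    intro x hx
    refine abs_im_integral_logDeriv_vertical_le_pi x ht.le (fun y hy ↦ ?_) hx
    exact analyticAt_logDeriv_riemannZeta (hne1 hy.1) (ne_zero_of_re_logDeriv_neg (hx y hy)).1
  have hL := vert h_left
  have hR := vert h_right
  -- combine
  have habs : |2 * π * ((lmBoxDerivCount b t₁ t₂ - lmBoxCount b t₁ t₂ : ℤ) : ℝ)| =
      2 * π * |((lmBoxDerivCount b t₁ t₂ - lmBoxCount b t₁ t₂ : ℤ) : ℝ)| := by
    rw [abs_mul, abs_of_pos Real.two_pi_pos]
  rw [← habs, ← him]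
  rw [abs_le] at hB hT hL hR ⊢
  constructor <;> linarith [hB.1, hB.2, hT.1, hT.2, hL.1, hL.2, hR.1, hR.2]

/-- **Zero change of argument** (LM §2, proof of (1.2): "`Re ζ'/ζ < 0` and so the change in
`arg ζ'/ζ` is `0` on the contour. Thus the number of zeros of `ζ'` and `ζ` are the same inside
the contour"): if `Re ζ'/ζ < 0` on all four edges of `K = [0,b] × [t₁,t₂]` (`0 < b`,
`0 < t₁ < t₂`), then `N₁(K) = N(K)`. [cite: LevinsonMontgomery1974, §2] -/
theorem lmBoxDerivCount_eq_lmBoxCount_of_re_neg {b t₁ t₂ : ℝ} (hb : 0 < b) (ht₁ : 0 < t₁)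
    (ht : t₁ < t₂)
    (h_bot : ∀ x ∈ Icc 0 b, (logDeriv riemannZeta (x + t₁ * I)).re < 0)
    (h_top : ∀ x ∈ Icc 0 b, (logDeriv riemannZeta (x + t₂ * I)).re < 0)
    (h_left : ∀ y ∈ Icc t₁ t₂, (logDeriv riemannZeta (((0 : ℝ) : ℂ) + y * I)).re < 0)
    (h_right : ∀ y ∈ Icc t₁ t₂, (logDeriv riemannZeta (b + y * I)).re < 0) :
    lmBoxDerivCount b t₁ t₂ = lmBoxCount b t₁ t₂ := by
  have hid := rectBoundaryIntegral_logDeriv_logDeriv_riemannZeta hb ht₁ ht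
    (fun x hx ↦ ne_zero_of_re_logDeriv_neg (h_bot x hx))
    (fun x hx ↦ ne_zero_of_re_logDeriv_neg (h_top x hx))
    (fun y hy ↦ ne_zero_of_re_logDeriv_neg (h_left y hy))
    (fun y hy ↦ ne_zero_of_re_logDeriv_neg (h_right y hy))
  have hne1 : ∀ {x y : ℝ}, t₁ ≤ y → (x : ℂ) + y * I ≠ 1 := fun hy ↦
    ofReal_add_mul_I_ne_one_of_im_pos (by linarith)
  have han : ∀ {x y : ℝ}, t₁ ≤ y → (logDeriv riemannZeta (x + y * I)).re < 0 →
      AnalyticAt ℂ (logDeriv riemannZeta) (x + y * I) := fun hy h ↦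
    analyticAt_logDeriv_riemannZeta (hne1 hy) (ne_zero_of_re_logDeriv_neg h).1
  have h0 := Literature.Analysis.Complex.integral_boundary_rect_logDeriv_eq_zero_of_re_neg (g := logDeriv riemannZeta)
    hb.le ht.le
    (fun x hx ↦ han le_rfl (h_bot x hx)) (fun x hx ↦ han ht.le (h_top x hx))
    (fun y hy ↦ han hy.1 (h_left y hy)) (fun y hy ↦ han hy.1 (h_right y hy))
    h_bot h_top h_left h_right
  rw [Literature.Analysis.Complex.rectBoundaryIntegral_def, h0] at hid
  have him := congrArg Complex.im hid
  rw [im_two_pi_I_mul_intCast, zero_im] at him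
  have : ((lmBoxDerivCount b t₁ t₂ - lmBoxCount b t₁ t₂ : ℤ) : ℝ) = 0 := by
    have h2 : (0 : ℝ) < 2 * π := Real.two_pi_pos
    nlinarith
  exact_mod_cast (sub_eq_zero.1 (by exact_mod_cast this) : lmBoxDerivCount b t₁ t₂ = lmBoxCount b t₁ t₂)

/-! ## From the box to `N₁⁻(T) - N⁻(T)` -/

/-- **One step of (1.1).** Let `10 ≤ t₁ < t₂ ≤ T`; assume `ζ ζ' ≠ 0` on the open segments
`(0,½) × {t₁}`, `(0,½) × {t₂}` and that no zero of `ζ` or `ζ'` with `0 < σ < ½` has height in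
`[t₂, T)`. Then
`2π |(N₁⁻(T) - N⁻(T)) - (N₁⁻(t₁) - N⁻(t₁))| ≤ E(t₁) + E(t₂) + 2π`.
[cite: LevinsonMontgomery1974, §2] -/
theorem two_pi_mul_abs_sub_sub_le {t₁ t₂ T : ℝ} (ht₁ : 10 ≤ t₁) (h12 : t₁ < t₂) (h2T : t₂ ≤ T)
    (H1 : ∀ x ∈ Ioo (0 : ℝ) (1 / 2),
      riemannZeta (x + t₁ * I) ≠ 0 ∧ deriv riemannZeta (x + t₁ * I) ≠ 0)
    (H2 : ∀ x ∈ Ioo (0 : ℝ) (1 / 2),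
      riemannZeta (x + t₂ * I) ≠ 0 ∧ deriv riemannZeta (x + t₂ * I) ≠ 0)
    (H3 : ∀ ρ : ℂ, (riemannZeta ρ = 0 ∨ deriv riemannZeta ρ = 0) → 0 < ρ.re → ρ.re < 1 / 2 →
      t₂ ≤ ρ.im → ρ.im < T → False) :
    2 * π * |((derivZetaLeftCount T : ℝ) - zetaLeftCount T) -
        ((derivZetaLeftCount t₁ : ℝ) - zetaLeftCount t₁)| ≤
      (lmEdgeBound 400 t₁ + lmEdgeBound (16 / 15) t₁) +
        (lmEdgeBound 400 t₂ + lmEdgeBound (16 / 15) t₂) + 2 * π := by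
  obtain ⟨b, hb0, hb, hzero, h_bot, h_top, h_left, h_right⟩ := exists_lmBox ht₁ h12 H1 H2
  have hρeq : ∀ ρ : ℂ, ((ρ.re : ℝ) : ℂ) + (ρ.im : ℝ) * I = ρ := fun ρ ↦ by
    apply Complex.ext <;> simp
  -- separation hypotheses
  have hsepζ : ∀ ρ ∈ zetaLeftBox T, ρ.im ≠ t₁ ∧ (t₁ < ρ.im → ρ.re < b ∧ ρ.im < t₂) := by
    rintro ρ ⟨h0, h1, h2, h3, h4⟩
    refine ⟨fun him ↦ ?_, fun hgt ↦ ?_⟩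
    · have := (H1 ρ.re ⟨h1, h2⟩).1
      rw [← him, hρeq] at this
      exact this h0
    · have hlt : ρ.im < t₂ := by
        by_contra hle
        exact H3 ρ (Or.inl h0) h1 h2 (not_lt.1 hle) h4
      refine ⟨hzero ρ (Or.inl h0) h1 h2 ?_ ?_, hlt⟩
      · rw [abs_of_pos h3]; linarith
      · rw [abs_of_pos h3]; exact hlt.le
  have hsepζ' : ∀ ρ ∈ derivZetaLeftBox T, ρ.im ≠ t₁ ∧ (t₁ < ρ.im → ρ.re < b ∧ ρ.im < t₂) := by
    rintro ρ ⟨h0, h1, h2, h3, h4⟩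
    refine ⟨fun him ↦ ?_, fun hgt ↦ ?_⟩
    · have := (H1 ρ.re ⟨h1, h2⟩).2
      rw [← him, hρeq] at this
      exact this h0
    · have hlt : ρ.im < t₂ := by
        by_contra hle
        exact H3 ρ (Or.inr h0) h1 h2 (not_lt.1 hle) h4
      refine ⟨hzero ρ (Or.inr h0) h1 h2 ?_ ?_, hlt⟩
      · rw [abs_of_pos h3]; linarith
      · rw [abs_of_pos h3]; exact hlt.le
  have hN := zetaLeftCount_eq_add_lmBoxCount hb.le (by linarith) h12.le h2T hsepζ
  have hN₁ := derivZetaLeftCount_eq_add_lmBoxDerivCount hb.le (by linarith) h12.le h2T hsepζ'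
  have hbox := two_pi_mul_abs_sub_le hb0 hb.le ht₁ h12 h_bot h_top h_left h_right
  have hcast : ((derivZetaLeftCount T : ℝ) - zetaLeftCount T) -
      ((derivZetaLeftCount t₁ : ℝ) - zetaLeftCount t₁) =
      ((lmBoxDerivCount b t₁ t₂ - lmBoxCount b t₁ t₂ : ℤ) : ℝ) := by
    have e1 : ((derivZetaLeftCount T : ℕ) : ℝ) = ((derivZetaLeftCount T : ℤ) : ℝ) := by simp
    have e2 : ((zetaLeftCount T : ℕ) : ℝ) = ((zetaLeftCount T : ℤ) : ℝ) := by simp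
    have e3 : ((derivZetaLeftCount t₁ : ℕ) : ℝ) = ((derivZetaLeftCount t₁ : ℤ) : ℝ) := by simp
    have e4 : ((zetaLeftCount t₁ : ℕ) : ℝ) = ((zetaLeftCount t₁ : ℤ) : ℝ) := by simp
    rw [e1, e2, e3, e4, hN, hN₁]
    push_cast
    ring
  rw [hcast]
  exact hbox

/-- **Between good edges the difference is constant** (LM §2, proof of (1.2)): if
`10 ≤ t₁ < T` and `Re ζ'/ζ < 0` on `[0,½) × {t₁}` and on `[0,½) × {T}`, then
`N₁⁻(T) - N⁻(T) = N₁⁻(t₁) - N⁻(t₁)`. [cite: LevinsonMontgomery1974, §2] -/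
theorem derivZetaLeftCount_sub_eq_of_re_neg {t₁ T : ℝ} (ht₁ : 10 ≤ t₁) (h1T : t₁ < T)
    (h_bot : ∀ x ∈ Ico (0 : ℝ) (1 / 2), (logDeriv riemannZeta (x + t₁ * I)).re < 0)
    (h_top : ∀ x ∈ Ico (0 : ℝ) (1 / 2), (logDeriv riemannZeta (x + T * I)).re < 0) :
    (derivZetaLeftCount T : ℤ) - zetaLeftCount T = derivZetaLeftCount t₁ - zetaLeftCount t₁ := by
  have H1 : ∀ x ∈ Ioo (0 : ℝ) (1 / 2),
      riemannZeta (x + t₁ * I) ≠ 0 ∧ deriv riemannZeta (x + t₁ * I) ≠ 0 :=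
    fun x hx ↦ ne_zero_of_re_logDeriv_neg (h_bot x ⟨hx.1.le, hx.2⟩)
  have H2 : ∀ x ∈ Ioo (0 : ℝ) (1 / 2),
      riemannZeta (x + T * I) ≠ 0 ∧ deriv riemannZeta (x + T * I) ≠ 0 :=
    fun x hx ↦ ne_zero_of_re_logDeriv_neg (h_top x ⟨hx.1.le, hx.2⟩)
  obtain ⟨b, hb0, hb, hzero, -, -, h_left, h_right⟩ := exists_lmBox ht₁ h1T H1 H2
  have hρeq : ∀ ρ : ℂ, ((ρ.re : ℝ) : ℂ) + (ρ.im : ℝ) * I = ρ := fun ρ ↦ by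
    apply Complex.ext <;> simp
  have hsepζ : ∀ ρ ∈ zetaLeftBox T, ρ.im ≠ t₁ ∧ (t₁ < ρ.im → ρ.re < b ∧ ρ.im < T) := by
    rintro ρ ⟨h0, h1, h2, h3, h4⟩
    refine ⟨fun him ↦ ?_, fun hgt ↦ ⟨hzero ρ (Or.inl h0) h1 h2 ?_ ?_, h4⟩⟩
    · have := (H1 ρ.re ⟨h1, h2⟩).1
      rw [← him, hρeq] at this
      exact this h0
    · rw [abs_of_pos h3]; linarith
    · rw [abs_of_pos h3]; exact h4.le
  have hsepζ' : ∀ ρ ∈ derivZetaLeftBox T, ρ.im ≠ t₁ ∧ (t₁ < ρ.im → ρ.re < b ∧ ρ.im < T) := by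
    rintro ρ ⟨h0, h1, h2, h3, h4⟩
    refine ⟨fun him ↦ ?_, fun hgt ↦ ⟨hzero ρ (Or.inr h0) h1 h2 ?_ ?_, h4⟩⟩
    · have := (H1 ρ.re ⟨h1, h2⟩).2
      rw [← him, hρeq] at this
      exact this h0
    · rw [abs_of_pos h3]; linarith
    · rw [abs_of_pos h3]; exact h4.le
  have hN := zetaLeftCount_eq_add_lmBoxCount hb.le (by linarith) h1T.le le_rfl hsepζ
  have hN₁ := derivZetaLeftCount_eq_add_lmBoxDerivCount hb.le (by linarith) h1T.le le_rfl hsepζ'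
  have heq := lmBoxDerivCount_eq_lmBoxCount_of_re_neg hb0 (by linarith) h1T
    (fun x hx ↦ h_bot x ⟨hx.1, lt_of_le_of_lt hx.2 hb⟩)
    (fun x hx ↦ h_top x ⟨hx.1, lt_of_le_of_lt hx.2 hb⟩) h_left h_right
  rw [hN, hN₁, heq]
  ring

/-! ## Theorem 1 (1.1) -/

/-- `E(t) = lmEdgeBound 400 t + lmEdgeBound (16/15) t ≤ 498 log t` for `t ≥ 16`. [folklore] -/
lemma lmEdgeBound_add_le {t : ℝ} (ht : 16 ≤ t) :
    lmEdgeBound 400 t + lmEdgeBound (16 / 15) t ≤ 498 * Real.log t := by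
  have h1 := lmEdgeBound_le_log (A := 400) (by norm_num) (by norm_num) ht
  have h2 := lmEdgeBound_le_log (A := 16 / 15) (by norm_num) (by norm_num) ht
  linarith

/-- The heights of the zeros of `ζ` and `ζ'` in `R_T` form a finite set. [folklore] -/
lemma finite_im_zeros (T : ℝ) : (Complex.im '' (zetaLeftBox T ∪ derivZetaLeftBox T)).Finite :=
  ((zetaLeftBox_finite T).union (derivZetaLeftBox_finite T)).image _

/-- **Levinson–Montgomery, Theorem 1 (1.1), proved**: `N₁⁻(T) = N⁻(T) + O(log T)`.
Bottom edge at a fixed height `t₁ ∈ [16,17]` and top edge at a height `t₂ ∈ [T-½, T)` above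
the last zero below `T`, both free of zeros of `ζ ζ'`; the box estimate `two_pi_mul_abs_sub_sub_le`
and `lmEdgeBound ≤ 249 log`. [cite: LevinsonMontgomery1974, Thm. 1 (1.1)] -/
theorem levinsonMontgomery_thm1_isBigO_holds : levinsonMontgomery_thm1_isBigO := by
  -- the bottom height
  obtain ⟨t₁, ht₁mem, ht₁not⟩ : ∃ t₁ ∈ Icc (16 : ℝ) 17, t₁ ∉ (finite_im_zeros 18).toFinset :=
    Set.Infinite.exists_notMem_finset (Icc_infinite (by norm_num)) _
  rw [Set.Finite.mem_toFinset] at ht₁not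
  have H1 : ∀ x ∈ Ioo (0 : ℝ) (1 / 2),
      riemannZeta (x + t₁ * I) ≠ 0 ∧ deriv riemannZeta (x + t₁ * I) ≠ 0 := by
    intro x hx
    constructor
    · intro h0
      exact ht₁not ⟨x + t₁ * I, Or.inl ⟨h0, by simpa using hx.1, by simpa using hx.2,
        by simp; linarith [ht₁mem.1], by simp; linarith [ht₁mem.2]⟩, by simp⟩
    · intro h0
      exact ht₁not ⟨x + t₁ * I, Or.inr ⟨h0, by simpa using hx.1, by simpa using hx.2,
        by simp; linarith [ht₁mem.1], by simp; linarith [ht₁mem.2]⟩, by simp⟩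
  set D : ℝ → ℝ := fun T ↦ (derivZetaLeftCount T : ℝ) - zetaLeftCount T with hD
  -- the bound for `T ≥ 18`
  have key : ∀ T : ℝ, 18 ≤ T → |D T| ≤ (|D t₁| + 161) * Real.log T := by
    intro T hT
    -- the top height `t₂`
    set S : Finset ℝ := (finite_im_zeros T).toFinset with hS
    set S' : Finset ℝ := insert (T - 1) (S.filter fun γ ↦ T - 1 ≤ γ) with hS'
    have hS'ne : S'.Nonempty := Finset.insert_nonempty _ _
    set γ₀ : ℝ := S'.max' hS'ne with hγ₀
    have hγ₀ge : T - 1 ≤ γ₀ := Finset.le_max' _ _ (Finset.mem_insert_self _ _)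
    have hmemS : ∀ ρ : ℂ, (riemannZeta ρ = 0 ∨ deriv riemannZeta ρ = 0) → 0 < ρ.re →
        ρ.re < 1 / 2 → 0 < ρ.im → ρ.im < T → ρ.im ∈ S := by
      intro ρ hρ h1 h2 h3 h4
      rw [hS, Set.Finite.mem_toFinset]
      rcases hρ with h0 | h0
      · exact ⟨ρ, Or.inl ⟨h0, h1, h2, h3, h4⟩, rfl⟩
      · exact ⟨ρ, Or.inr ⟨h0, h1, h2, h3, h4⟩, rfl⟩
    have hγ₀lt : γ₀ < T := by
      rw [hγ₀, Finset.max'_lt_iff]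
      intro γ hγ
      rw [hS', Finset.mem_insert, Finset.mem_filter] at hγ
      rcases hγ with rfl | ⟨hγ, -⟩
      · linarith
      · rw [hS, Set.Finite.mem_toFinset] at hγ
        obtain ⟨ρ, hρ, rfl⟩ := hγ
        rcases hρ with ⟨-, -, -, -, h⟩ | ⟨-, -, -, -, h⟩ <;> exact h
    have hle_γ₀ : ∀ γ ∈ S, T - 1 ≤ γ → γ ≤ γ₀ := fun γ hγ h ↦
      Finset.le_max' _ _ (by rw [hS']; exact Finset.mem_insert_of_mem (Finset.mem_filter.2 ⟨hγ, h⟩))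
    set t₂ : ℝ := (γ₀ + T) / 2 with ht₂
    have ht₂lt : t₂ < T := by rw [ht₂]; linarith
    have ht₂ge : T - 1 / 2 ≤ t₂ := by rw [ht₂]; linarith
    have hγ₀t₂ : γ₀ < t₂ := by rw [ht₂]; linarith
    have H2 : ∀ x ∈ Ioo (0 : ℝ) (1 / 2),
        riemannZeta (x + t₂ * I) ≠ 0 ∧ deriv riemannZeta (x + t₂ * I) ≠ 0 := by
      intro x hx
      have aux : (riemannZeta (x + t₂ * I) = 0 ∨ deriv riemannZeta (x + t₂ * I) = 0) → False := by
        intro h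
        have hm := hmemS (x + t₂ * I) h (by simpa using hx.1) (by simpa using hx.2)
          (by simp; linarith) (by simpa using ht₂lt)
        have := hle_γ₀ _ hm (by simp; linarith)
        simp at this
        linarith
      exact ⟨fun h ↦ aux (Or.inl h), fun h ↦ aux (Or.inr h)⟩
    have H3 : ∀ ρ : ℂ, (riemannZeta ρ = 0 ∨ deriv riemannZeta ρ = 0) → 0 < ρ.re →
        ρ.re < 1 / 2 → t₂ ≤ ρ.im → ρ.im < T → False := by
      intro ρ hρ h1 h2 h3 h4
      have hm := hmemS ρ hρ h1 h2 (by linarith) h4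
      have := hle_γ₀ _ hm (by linarith)
      linarith
    have hstep := two_pi_mul_abs_sub_sub_le (by linarith [ht₁mem.1]) (by linarith [ht₁mem.2])
      ht₂lt.le H1 H2 H3
    -- sizes of the edge bounds
    have hlogT : 1 ≤ Real.log T := by
      rw [← Real.log_exp 1]
      exact Real.log_le_log (Real.exp_pos 1)
        (by linarith [Real.exp_one_lt_d9.le.trans (by norm_num : (2.7182818286 : ℝ) ≤ 18)])
    have hlogt₂ : Real.log t₂ ≤ Real.log T := Real.log_le_log (by linarith) ht₂lt.le
    have hlogt₁ : Real.log t₁ ≤ Real.log T := Real.log_le_log (by linarith [ht₁mem.1])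
      (by linarith [ht₁mem.2])
    have hE₁ := lmEdgeBound_add_le ht₁mem.1
    have hE₂ := lmEdgeBound_add_le (t := t₂) (by linarith)
    have hπ : (996 : ℝ) ≤ 320 * π := by nlinarith [Real.pi_gt_d2]
    have hπ0 : 0 < π := Real.pi_pos
    -- |D T - D t₁| ≤ 160 log T + 1
    have hdiff : |D T - D t₁| ≤ 160 * Real.log T + 1 := by
      have h1 : 2 * π * |D T - D t₁| ≤ 996 * Real.log T + 2 * π := by
        simp only [hD] at hstep ⊢
        nlinarith [hstep, hE₁, hE₂, hlogt₁, hlogt₂]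
      have h2 : 2 * π * |D T - D t₁| ≤ 2 * π * (160 * Real.log T + 1) := by nlinarith
      exact le_of_mul_le_mul_left h2 (by positivity)
    calc |D T| = |D t₁ + (D T - D t₁)| := by ring_nf
      _ ≤ |D t₁| + |D T - D t₁| := abs_add_le _ _
      _ ≤ |D t₁| + (160 * Real.log T + 1) := by linarith
      _ ≤ (|D t₁| + 161) * Real.log T := by nlinarith [abs_nonneg (D t₁)]
  -- conclusion
  refine IsBigO.of_bound (|D t₁| + 161) ?_
  filter_upwards [eventually_ge_atTop (18 : ℝ)] with T hT
  have hlogpos : 0 < Real.log T := Real.log_pos (by linarith)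
  rw [Real.norm_eq_abs, Real.norm_eq_abs, abs_of_pos hlogpos]
  exact key T hT

/-! ## Theorem 1 (1.2) -/

/-- A natural-number-valued injection from the bad integer heights: two integers at distance
`< ½` from the same real number are equal. [folklore] -/
lemma natCast_eq_of_abs_sub_lt {m m' : ℕ} {γ : ℝ} (h : |(m : ℝ) - γ| < 1 / 2)
    (h' : |(m' : ℝ) - γ| < 1 / 2) : m = m' := by
  have h1 : |(m : ℝ) - m'| < 1 := by
    calc |(m : ℝ) - m'| = |((m : ℝ) - γ) - ((m' : ℝ) - γ)| := by ring_nf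
      _ ≤ |(m : ℝ) - γ| + |(m' : ℝ) - γ| := abs_sub _ _
      _ < 1 := by linarith
  have h2 : |((m : ℤ) - m' : ℤ)| < 1 := by exact_mod_cast h1
  rw [abs_lt] at h2
  omega

/-- **The dichotomy of LM §2**: unless `N⁻(T) > T/2` for all large `T`, there are arbitrarily
large *good* integer heights ("if `t` is taken as an integer `n`, then there is at least one
zero `ρ` with `β < ½` and `|γ - n| < ½` ... Hence `N⁻(T) > T/2` for large `T`").
[cite: LevinsonMontgomery1974, §2] -/
theorem frequently_lmGood_nat (hnot : ¬ ∀ᶠ T : ℝ in atTop, T / 2 < (zetaLeftCount T : ℝ))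
    (n : ℕ) : ∃ m : ℕ, n ≤ m ∧ lmGood m := by
  by_contra hcon
  push Not at hcon
  apply hnot
  set n₁ : ℕ := max n 1 with hn₁
  have hz : ∀ m : ℕ, n₁ ≤ m →
      ∃ ρ : ℂ, riemannZeta ρ = 0 ∧ 0 < ρ.re ∧ ρ.re < 1 / 2 ∧ |(m : ℝ) - ρ.im| < 1 / 2 :=
    fun m hm ↦ exists_zero_near_of_not_lmGood (hcon m (le_of_max_le_left hm))
  choose! ρ hρ using hz
  rw [eventually_atTop]
  refine ⟨2 * (n₁ : ℝ) + 4, fun T hT ↦ ?_⟩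
  have hn₁1 : (1 : ℝ) ≤ n₁ := by exact_mod_cast le_max_right n 1
  set M : ℕ := ⌊T - 1 / 2⌋₊ with hM
  have hT0 : 0 ≤ T - 1 / 2 := by linarith
  have hMle : (M : ℝ) ≤ T - 1 / 2 := Nat.floor_le hT0
  have hMgt : T - 1 / 2 < M + 1 := Nat.lt_floor_add_one _
  have hn₁M : n₁ ≤ M + 1 := by
    have : (n₁ : ℝ) ≤ M + 1 := by linarith
    exact_mod_cast this
  -- the zeros attached to `n₁ ≤ m ≤ M` are distinct and lie in `R_T`
  have hinj : Set.InjOn ρ (Finset.Icc n₁ M : Set ℕ) := by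
    intro m hm m' hm' heq
    rw [Finset.coe_Icc] at hm hm'
    have h1 := (hρ m hm.1).2.2.2
    have h2 := (hρ m' hm'.1).2.2.2
    rw [heq] at h1
    exact natCast_eq_of_abs_sub_lt h1 h2
  have hmem : ∀ ρ' ∈ (Finset.Icc n₁ M).image ρ, ρ' ∈ zetaLeftBox T := by
    intro ρ' hρ'
    rw [Finset.mem_image] at hρ'
    obtain ⟨m, hm, rfl⟩ := hρ'
    rw [Finset.mem_Icc] at hm
    obtain ⟨h0, h1, h2, h3⟩ := hρ m hm.1
    have hm1 : (n₁ : ℝ) ≤ m := by exact_mod_cast hm.1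
    have hm2 : (m : ℝ) ≤ M := by exact_mod_cast hm.2
    rw [abs_lt] at h3
    exact ⟨h0, h1, h2, by linarith, by linarith⟩
  have hcard := card_le_zetaLeftCount _ hmem
  rw [Finset.card_image_of_injOn hinj, Nat.card_Icc] at hcard
  have hcardR : ((M + 1 - n₁ : ℕ) : ℝ) ≤ zetaLeftCount T := by exact_mod_cast hcard
  rw [Nat.cast_sub hn₁M] at hcardR
  push_cast at hcardR
  linarith

/-- `t = 10` is a good height if `ζ` has no zeros in `(0,½) × (0, 10.5]` (zeros with
`½ < β < 1` are reflected by `ρ ↦ 1 - ρ̄`). [folklore] -/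
lemma lmGood_ten
    (hζ : ∀ s : ℂ, 0 < s.re → s.re < 1 / 2 → 0 < s.im → s.im ≤ 21 / 2 → riemannZeta s ≠ 0) :
    lmGood 10 := by
  by_contra h
  obtain ⟨ρ, h0, h1, h2, h3⟩ := exists_zero_near_of_not_lmGood h
  rw [abs_lt] at h3
  exact hζ ρ h1 h2 (by linarith) (by linarith) h0

/-- **Levinson–Montgomery, Theorem 1 (1.2), from the low-height facts.** If `ζ` has no zeros in
`(0,½) × (0, 10.5]` and `ζ'` none in `(0,½) × (0, 10]` (both classical numerical facts: Gram
1903 / `Literature.RiemannHypothesisInStripUpTo 50`, and `spira1965_deriv_riemannZeta_ne_zero`), then unless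
`N⁻(T) > T/2` for all large `T` there is `T_j → ∞` with `N₁⁻(T_j) = N⁻(T_j)`: the `T_j` are good
integer heights (`frequently_lmGood_nat`), `t = 10` is good, so `Re ζ'/ζ < 0` on the whole
boundary of `[0, ½-δ] × [10, T_j]` and `N₁⁻(T_j) - N⁻(T_j) = N₁⁻(10) - N⁻(10) = 0`.
[cite: LevinsonMontgomery1974, Thm. 1 (1.2)] -/
theorem levinsonMontgomery_thm1_seq_of
    (hζ : ∀ s : ℂ, 0 < s.re → s.re < 1 / 2 → 0 < s.im → s.im ≤ 21 / 2 → riemannZeta s ≠ 0)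
    (hζ' : ∀ s : ℂ, 0 < s.re → s.re < 1 / 2 → 0 < s.im → s.im ≤ 10 → deriv riemannZeta s ≠ 0) :
    levinsonMontgomery_thm1_seq := by
  intro hnot
  choose m hm using frequently_lmGood_nat hnot
  refine ⟨fun j ↦ (m (j + 11) : ℝ), ?_, fun j ↦ ?_⟩
  · refine tendsto_atTop_atTop.2 fun x ↦ ⟨⌈x⌉₊, fun j hj ↦ ?_⟩
    have h1 : (j : ℝ) + 11 ≤ m (j + 11) := by exact_mod_cast (hm (j + 11)).1
    have h2 : x ≤ (⌈x⌉₊ : ℝ) := Nat.le_ceil x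
    have h3 : (⌈x⌉₊ : ℝ) ≤ j := by exact_mod_cast hj
    linarith
  · set T : ℝ := (m (j + 11) : ℝ) with hT
    have hT11 : (11 : ℝ) ≤ T := by
      have := (hm (j + 11)).1
      rw [hT]; exact_mod_cast le_of_add_le_right this
    have hgoodT : lmGood T := (hm (j + 11)).2
    have hgood10 : lmGood 10 := lmGood_ten hζ
    have h_bot : ∀ x ∈ Ico (0 : ℝ) (1 / 2), (logDeriv riemannZeta (x + (10 : ℝ) * I)).re < 0 :=
      fun x hx ↦ re_logDeriv_riemannZeta_neg_of_lmGood' (by simpa using hgood10) (by simp)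
        (by simpa using hx.1) (by simpa using hx.2)
    have h_top : ∀ x ∈ Ico (0 : ℝ) (1 / 2), (logDeriv riemannZeta (x + T * I)).re < 0 :=
      fun x hx ↦ re_logDeriv_riemannZeta_neg_of_lmGood' (by simpa using hgoodT)
        (by simp [abs_of_nonneg (show (0:ℝ) ≤ T by linarith)]; linarith)
        (by simpa using hx.1) (by simpa using hx.2)
    have heq := derivZetaLeftCount_sub_eq_of_re_neg (t₁ := 10) (T := T) (by norm_num)
      (by linarith) h_bot h_top
    -- `N⁻(10) = N₁⁻(10) = 0`
    have hN : zetaLeftCount 10 = 0 := by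
      have : zetaLeftBox 10 = ∅ := by
        ext ρ
        simp only [Set.mem_empty_iff_false, iff_false]
        rintro ⟨h0, h1, h2, h3, h4⟩
        exact hζ ρ h1 h2 h3 (by linarith) h0
      simp [zetaLeftCount, this]
    have hN₁ : derivZetaLeftCount 10 = 0 := by
      have : derivZetaLeftBox 10 = ∅ := by
        ext ρ
        simp only [Set.mem_empty_iff_false, iff_false]
        rintro ⟨h0, h1, h2, h3, h4⟩
        exact hζ' ρ h1 h2 h3 h4.le h0
      simp [derivZetaLeftCount, this]
    rw [hN, hN₁] at heq
    simp only [CharP.cast_eq_zero, sub_self, sub_eq_zero, Nat.cast_inj] at heq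
    exact heq

/-! ## Spira's numerical fact, as printed, and Speiser's theorem -/

/-- **Spira's computation (1965)**: "`ζ'(s) ≠ 0` for `0 < σ < ½`, `0 < |t| ≤ 200` (although
only the region `|t| ≤ 100` was reported on)" — Spira, Illinois J. Math. 17 (1973), p. 149,
on the calculation of R. Spira, *Zero-free regions of `ζ^{(k)}(s)`*, J. London Math. Soc. 40
(1965), 677–682; this is the low-height input tacitly used by Levinson–Montgomery for (1.2).
Vendored in the reported range `|t| ≤ 100`. Users take
`(h : spira1965_deriv_riemannZeta_ne_zero)`. [cite: Spira1973, p. 149] -/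
def spira1965_deriv_riemannZeta_ne_zero : Prop :=
  ∀ s : ℂ, 0 < s.re → s.re < 1 / 2 → 0 < |s.im| → |s.im| ≤ 100 → deriv riemannZeta s ≠ 0

/-- **Speiser's theorem from the two low-height facts**: `levinsonMontgomery_thm1_isBigO_holds`,
`levinsonMontgomery_thm1_seq_of` and the tree's assembly
`speiser_iff_of_levinsonMontgomery_thm1`. [cite: LevinsonMontgomery1974, Cor. to Thm. 1] -/
theorem speiser_iff_of_lowHeight
    (hζ : ∀ s : ℂ, 0 < s.re → s.re < 1 / 2 → 0 < s.im → s.im ≤ 21 / 2 → riemannZeta s ≠ 0)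
    (hζ' : ∀ s : ℂ, 0 < s.re → s.re < 1 / 2 → 0 < s.im → s.im ≤ 10 → deriv riemannZeta s ≠ 0) :
    speiser_iff :=
  speiser_iff_of_levinsonMontgomery_thm1 levinsonMontgomery_thm1_isBigO_holds
    (levinsonMontgomery_thm1_seq_of hζ hζ') Literature.NumberTheory.LFunctions.mem_riemannZetaNontrivialZeros_iff_holds

/-- **Speiser's theorem from numerical RH up to height `50` and Spira's computation** (the
inputs Levinson–Montgomery quote: "`β = ½` for `|γ| < 1000`", for which Gram's 1903 verification
`0 ≤ Im s ≤ 50` — Edwards, *Riemann's Zeta Function* §6.1 — already suffices, in the tree's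
strip form `Literature.RiemannHypothesisInStripUpTo 50`; and Spira 1965).
[cite: LevinsonMontgomery1974, Cor. to Thm. 1] -/
theorem speiser_iff_of_rhUpTo_spira (h₁ : Literature.NumberTheory.LFunctions.RiemannHypothesisInStripUpTo 50)
    (h₂ : spira1965_deriv_riemannZeta_ne_zero) : speiser_iff :=
  speiser_iff_of_lowHeight
    (fun s h0 h1 h2 h3 hs ↦ by
      have := h₁ s hs h0 (by linarith) (by rw [abs_of_pos h2]; linarith)
      linarith)
    (fun s h0 h1 h2 h3 ↦ h₂ s h0 h1 (by rw [abs_of_pos h2]; exact h2)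
      (by rw [abs_of_pos h2]; linarith))

/-- **Speiser's theorem from the inventory's numerical RH (rh.S35, Platt–Trudgian 2021) and
Spira's computation.** [cite: LevinsonMontgomery1974, Cor. to Thm. 1] -/
theorem speiser_iff_of_platt_trudgian_spira (h₁ : platt_trudgian_numerical_rh)
    (h₂ : spira1965_deriv_riemannZeta_ne_zero) : speiser_iff :=
  speiser_iff_of_lowHeight
    (fun s h0 h1 h2 h3 hs ↦ by
      have := h₁ s hs h2 (by linarith)
      linarith)
    (fun s h0 h1 h2 h3 ↦ h₂ s h0 h1 (by rw [abs_of_pos h2]; exact h2)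
      (by rw [abs_of_pos h2]; linarith))

end Literature.NumberTheory.LFunctions

end
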